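/-
Copyright: the b2b-balaban T⁴-continuum CRUX team, row NE7b leaf lineage `t4-ne7b-formalise-leaf-05` (gen 157). Project licence.
-/
import Summits.QuantumFields.BalabanUV.T4Continuum.Spine.NE7b.AdmissibleFloorSeminormIMS

/-!
# THE SEMINORM-IMS FLOOR FOR LINEAR LOCAL TERMS ON BOND FIELDS — `…AdmissibleFloorSeminormIMS` with its four bookkeeping letters DISCHARGED for the
# shape the lattice instance has: fields `x : C → W`, terms `T_j x = Σ_{c ∈ inc j} R_{j,c}(x c)` (`R_{j,c}` real-linear, `‖R_{j,c}v‖ ≤ ℓ‖v‖`), cutoffs acting by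
# scalars `(h_s·x)(c) = h_s(c)•x(c)` with `Σ_s h_s(c)² = 1`, size `N(x) = Σ_c ‖x c‖²`: then (comm), (err) with `ε = μℓ²λ²ab`, (part) and `Φ ≥ 0` hold, and
# the floor reads `((c_loc − (1+t⁻¹)μℓ²λ²ab)∕(1+t))·Σ_c‖x c‖² ≤ F(x)` on `good` (row NE7b, node U5c; residual (R2′) family (2), letter (ℓ1); junction lemmas)

Cell `pub-balaban`, sub-cell `t4`, spine estimate NE7b (`T4WeightBudget.RelWeightBound`; the cell's OWN estimate — NOT PRINTED in [Bałaban 1983–89],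
NOT PROVED).  Crux-route work under `Spine/NE7b/`; NOTHING of Bałaban's is asserted; no `def`; zero `sorry`; no `T4Continuum/Support` leaf (FREEZE (0)).
Import: this lineage's `…AdmissibleFloorSeminormIMS` (AFSI; §2 `ims_floor_of_commutator`, §4 `admissible_floor_seminorm`, §5 `norm_term_cutoff_le`,
`ims_error_of_letters`).

WHY.  AFSI states the (h2) skeleton for abstract square-root functionals `Φ_j` on an abstract field type `E` with four bookkeeping letters ((comm), (err),
(part), `Φ ≥ 0`) and proves in its §5 the two that need work for LINEAR local terms.  THIS FILE is the one-theorem junction the k = 1 instance consumes: it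
fixes `E := C → W` (`W` any real normed space — `M_n(ℂ)` in either currency, `𝔲(n)`, `ℝ`), `Φ_j x := ‖T_j x‖`, `loc_s x := h_s•x`, `w_s(j) := h_s(c_j)`,
`ρ_{s,j}(x) := ℓΣ_{c∈inc j}|h_s(c) − h_s(c_j)|‖x c‖`, `N(x) := Σ_c‖x c‖²`, and discharges all four, so that the instance supplies ONLY: the incidence `inc` with
its counts `a, b`, the maps `R_{j,c}` with `ℓ`, the partition `h` with (Lip) `λ` and (mult) `μ`, the local floors on the localised admissible fields (from the
per-cube transport ∘ perturbation ∘ flat letters, AFSI §3), and `Σ_j‖T_j x‖² ≤ F(x)` on `good`.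

WHAT IS PROVED ([folklore]):
* §1 `sum_normSq_cutoff` — `Σ_s Σ_c ‖h_s(c)•x(c)‖² = Σ_c ‖x c‖²` for `Σ_s h_s(c)² = 1` (the (part) letter for `N = Σ‖·‖²`).
* §2 **`ims_floor_of_linear_terms`** — AFSI `ims_floor_of_commutator` with (comm) := `norm_term_cutoff_le`, (err) := `ims_error_of_letters`, (part) := §1,
  `hw` := the partition identity at `c_j`: local floors `c_loc·Σ_c‖h_s(c)•x(c)‖² ≤ Σ_j‖T_j(h_s•x)‖²` for `good x` and `Σ_j‖T_j x‖² ≤ F(x)` on `good` ⊢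
  `((c_loc − (1+t⁻¹)·μℓ²λ²ab)∕(1+t))·Σ_c‖x c‖² ≤ F(x)` for `good x`.
* §3 **`admissible_floor_linear_terms`** — the same with the local floors produced per cube from AFSI §4's five letters (cov)∕(iso)∕(adm)∕(pert)∕(flat)
  (`c_loc = c∕2 − δ`): `∀ x, good x → ((c∕2 − δ − (1+t⁻¹)μℓ²λ²ab)∕(1+t))·Σ_c‖x c‖² ≤ F x`.
* §4 toy: one term, one cube, `R = id` on `ℝ`, `h ≡ 1` (`λ = 0`): the floor `((1 − (1+1)·(1·1·0·1·1))∕2)·‖x‖² ≤ ‖x‖²` (`example`).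

NOT HERE (honest): the lattice data BY VALUE (`inc` = boundary bonds of plaquettes ∕ averaging paths of coarse bonds, `a = 4` resp. the path count, `b = 2(d−1)`
resp. …, `ℓ = 1`, `λ = c_h(L+1)∕M`, `μ ≤ 2·2^d`), the per-cube gauges (R-V), CCTL's (ℓ1) and (cov) as the (pert)∕(cov) suppliers, the flat floor in the
chosen currency; (A3) ∕ (A1c); NC-NE7b-α UNRULED.  BY-NAME EFFECT ON THE WALL: NONE.  NE7b NOT PRINTED ∕ NOT PROVED; spine PROVED 0∕9; rung (B)+1 on ONE
finite T⁴ — NOT infinite volume, NOT the mass gap, NOT Clay.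
HONEST DEPENDENCY: continuum YM on T⁴ ⇐ BetaPertH ∧ nine spine estimates (0/9 proved); BetaPertH ⇐ (D1) ∧ (D4) ∧ CAP+tail; G-an2-4 gates asym, D1 and NE2/3/4.
-/

set_option autoImplicit false

noncomputable section

open Finset
open Summit.QuantumFields.BalabanUV.T4Continuum.NE7b.AdmissibleFloorSeminormIMS
  (ims_floor_of_commutator norm_term_cutoff_le ims_error_of_letters)

namespace Summit.QuantumFields.BalabanUV.T4Continuum.NE7b.AdmissibleFloorSeminormTerms

variable {J ι C : Type*} [Fintype J] [Fintype ι] [Fintype C]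
variable {W V : Type*} [NormedAddCommGroup W] [NormedSpace ℝ W] [NormedAddCommGroup V] [NormedSpace ℝ V]

/-! ## §1 The size `Σ_c ‖x c‖²` splits under a quadratic partition of unity acting by scalars -/

omit [Fintype J] [NormedAddCommGroup V] [NormedSpace ℝ V] in
/-- `Σ_s Σ_c ‖h_s(c)•x(c)‖² = Σ_c ‖x c‖²` when `Σ_s h_s(c)² = 1`. [folklore] -/
theorem sum_normSq_cutoff (h : ι → C → ℝ) (hpart : ∀ c, ∑ s, h s c ^ 2 = 1) (x : C → W) :
    ∑ s, ∑ c, ‖h s c • x c‖ ^ 2 = ∑ c, ‖x c‖ ^ 2 := by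
  rw [Finset.sum_comm]
  refine Finset.sum_congr rfl fun c _ => ?_
  simp_rw [norm_smul, mul_pow, Real.norm_eq_abs, sq_abs]
  rw [← Finset.sum_mul, hpart c, one_mul]

/-! ## §2 The IMS floor for linear local terms -/

/-- **THE SEMINORM-IMS FLOOR FOR LINEAR LOCAL TERMS**: terms `T_j x = Σ_{c∈inc j} R_{j,c}(x c)` with `‖R_{j,c}v‖ ≤ ℓ‖v‖`, a quadratic partition of unity
`h` acting by scalars with (Lip) `|h_s(c) − h_s(c_j)| ≤ λ` on `inc j` and (mult) `≤ μ` cubes non-constant on a term, counts `#inc j ≤ a`, `#{j : c ∈ inc j} ≤ b`;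
local floors `c_loc·Σ_c‖h_s(c)•x(c)‖² ≤ Σ_j ‖T_j(h_s•x)‖²` for `good x`, and `Σ_j ‖T_j x‖² ≤ F x` on `good` ⊢
`((c_loc − (1+t⁻¹)·μℓ²λ²ab)∕(1+t))·Σ_c ‖x c‖² ≤ F x` (AFSI `ims_floor_of_commutator` with its four bookkeeping letters discharged). [folklore] -/
theorem ims_floor_of_linear_terms [DecidableEq C] (inc : J → Finset C) (R : J → C → W →ₗ[ℝ] V) {ℓ : ℝ}
    (hR : ∀ j c v, ‖R j c v‖ ≤ ℓ * ‖v‖)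
    (h : ι → C → ℝ) (hpart : ∀ c, ∑ s, h s c ^ 2 = 1) (ref : J → C)
    {lam : ℝ} (hlam : 0 ≤ lam) (hlip : ∀ s j, ∀ c ∈ inc j, |h s c - h s (ref j)| ≤ lam)
    {μ a b : ℕ} (hμ : ∀ j, (Finset.univ.filter fun s => ∃ c ∈ inc j, h s c ≠ h s (ref j)).card ≤ μ)
    (ha : ∀ j, (inc j).card ≤ a) (hb : ∀ c, (Finset.univ.filter fun j => c ∈ inc j).card ≤ b)
    (good : (C → W) → Prop) {cloc : ℝ}
    (hloc : ∀ s x, good x → cloc * ∑ c, ‖h s c • x c‖ ^ 2 ≤ ∑ j, ‖∑ c ∈ inc j, R j c (h s c • x c)‖ ^ 2)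
    (F : (C → W) → ℝ) (hF : ∀ x, good x → ∑ j, ‖∑ c ∈ inc j, R j c (x c)‖ ^ 2 ≤ F x)
    {t : ℝ} (ht : 0 < t) (x : C → W) (hx : good x) :
    (cloc - (1 + t⁻¹) * (μ * ℓ ^ 2 * lam ^ 2 * a * b)) / (1 + t) * ∑ c, ‖x c‖ ^ 2 ≤ F x :=
  ims_floor_of_commutator (fun j (x : C → W) => ‖∑ c ∈ inc j, R j c (x c)‖) (fun s x c => h s c • x c)
    (fun s j => h s (ref j)) (fun s j x => ℓ * ∑ c ∈ inc j, |h s c - h s (ref j)| * ‖x c‖)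
    (fun j => (hpart (ref j)).le) (fun _ _ => norm_nonneg _)
    (fun s j x => norm_term_cutoff_le inc R hR h ref x s j)
    (fun x => ∑ c, ‖x c‖ ^ 2) good (fun x _ => ims_error_of_letters inc h ref hlam hlip hμ ha hb x)
    (sum_normSq_cutoff h hpart) hloc F hF ht x hx

/-! ## §3 … with the local floors produced per cube from the five letters -/

/-- **THE (h2) SLOT FOR LINEAR LOCAL TERMS**: as `ims_floor_of_linear_terms`, the local floors now PRODUCED per cube `s` from a local gauge
`u_s : (C → W) → E′` into fields of size `N′_s` with (iso) `N′_s(u_s(h_s•x)) = Σ_c‖h_s(c)•x(c)‖²`, (cov) `Σ_j‖T_j(h_s•x)‖² = F′_s(u_s(h_s•x))`, (adm)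
`good x → good⁰_s(u_s(h_s•x))`, (pert) `F⁰_s Y∕2 − δN′_s Y ≤ F′_s Y` and (flat) `cN′_s Y ≤ F⁰_s Y` on `good⁰_s` ⊢
`∀ x, good x → ((c∕2 − δ − (1+t⁻¹)·μℓ²λ²ab)∕(1+t))·Σ_c‖x c‖² ≤ F x`. [folklore] -/
theorem admissible_floor_linear_terms [DecidableEq C] {E' : Type*} (inc : J → Finset C) (R : J → C → W →ₗ[ℝ] V) {ℓ : ℝ}
    (hR : ∀ j c v, ‖R j c v‖ ≤ ℓ * ‖v‖)
    (h : ι → C → ℝ) (hpart : ∀ c, ∑ s, h s c ^ 2 = 1) (ref : J → C)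
    {lam : ℝ} (hlam : 0 ≤ lam) (hlip : ∀ s j, ∀ c ∈ inc j, |h s c - h s (ref j)| ≤ lam)
    {μ a b : ℕ} (hμ : ∀ j, (Finset.univ.filter fun s => ∃ c ∈ inc j, h s c ≠ h s (ref j)).card ≤ μ)
    (ha : ∀ j, (inc j).card ≤ a) (hb : ∀ c, (Finset.univ.filter fun j => c ∈ inc j).card ≤ b)
    (good : (C → W) → Prop) {c δ : ℝ}
    (u : ι → (C → W) → E') (N' : ι → E' → ℝ) (F' F0 : ι → E' → ℝ) (good0 : ι → E' → Prop)
    (hiso : ∀ s x, good x → N' s (u s fun c' => h s c' • x c') = ∑ c', ‖h s c' • x c'‖ ^ 2)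
    (hcov : ∀ s x, good x → ∑ j, ‖∑ c' ∈ inc j, R j c' (h s c' • x c')‖ ^ 2 = F' s (u s fun c' => h s c' • x c'))
    (hadm : ∀ s x, good x → good0 s (u s fun c' => h s c' • x c'))
    (hpert : ∀ s Y, good0 s Y → F0 s Y / 2 - δ * N' s Y ≤ F' s Y)
    (hflat : ∀ s Y, good0 s Y → c * N' s Y ≤ F0 s Y)
    (F : (C → W) → ℝ) (hF : ∀ x, good x → ∑ j, ‖∑ c' ∈ inc j, R j c' (x c')‖ ^ 2 ≤ F x)
    {t : ℝ} (ht : 0 < t) :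
    ∀ x : C → W, good x → (c / 2 - δ - (1 + t⁻¹) * (μ * ℓ ^ 2 * lam ^ 2 * a * b)) / (1 + t) * ∑ c', ‖x c'‖ ^ 2 ≤ F x := by
  intro x hx
  have hloc : ∀ s x, good x → (c / 2 - δ) * ∑ c', ‖h s c' • x c'‖ ^ 2 ≤ ∑ j, ‖∑ c' ∈ inc j, R j c' (h s c' • x c')‖ ^ 2 := by
    intro s x hx
    rw [hcov s x hx, ← hiso s x hx]
    have h1 := hflat s _ (hadm s x hx)
    have h2 := hpert s _ (hadm s x hx)
    linarith
  exact ims_floor_of_linear_terms inc R hR h hpart ref hlam hlip hμ ha hb good hloc F hF ht x hx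

/-! ## §4 Toy: one term, one cube, `R = id` on `ℝ`, `h ≡ 1` -/

section Toy

/- `J = ι = C = Unit`, `W = V = ℝ`, `inc _ = {()}`, `R = id` (`ℓ = 1`), `h ≡ 1` (`λ = 0`, `μ = 1`), `a = b = 1`, `good = True`, `c_loc = 1`, `F x = ‖x ()‖²`,
`t = 1`: the floor `((1 − 2·(1·1²·0²·1·1))∕2)·‖x ()‖² ≤ ‖x ()‖²`. -/
example (x : Unit → ℝ) :
    (1 - (1 + (1 : ℝ)⁻¹) * ((1 : ℕ) * (1 : ℝ) ^ 2 * (0 : ℝ) ^ 2 * (1 : ℕ) * (1 : ℕ))) / (1 + 1) * ∑ c, ‖x c‖ ^ 2 ≤ ∑ c, ‖x c‖ ^ 2 := by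
  have h := ims_floor_of_linear_terms (J := Unit) (ι := Unit) (C := Unit) (W := ℝ) (V := ℝ)
    (fun _ => {()}) (fun _ _ => LinearMap.id) (ℓ := 1) (fun _ _ v => by simp)
    (fun _ _ => (1 : ℝ)) (fun _ => by simp) (fun _ => ()) (lam := 0) le_rfl (fun _ _ _ _ => by simp)
    (μ := 1) (a := 1) (b := 1) (fun _ => by simp) (fun _ => by simp) (fun _ => by simp)
    (fun _ => True) (cloc := 1) (fun _ y _ => by simp) (fun y => ∑ c, ‖y c‖ ^ 2) (fun y _ => by simp) one_pos x trivial
  simpa using h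

end Toy

end Summit.QuantumFields.BalabanUV.T4Continuum.NE7b.AdmissibleFloorSeminormTerms

end
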